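import Summits.HodgeConjecture.CorCM.Census.QuarticInversionTransport
import Summits.HodgeConjecture.CorCM.Census.QuarticInversionStabiliser
import Summits.HodgeConjecture.CorCM.Census.ClockTypesLaw

/-!
# THE QUARTIC INVERSION LAWS: `μ = β` for `Dic(ℤ/4 × B, c)` and `μ = β − 2` for `D(ℤ/4 × B)` (given a slot datum and a cross datum on `B`)

COR-CM (cell `pub-hodgecm2`, stage 2 of the Hodge ladder), count-neutral KERNEL COMBINATORICS by the binder seat b23 (gen 44; claim
QUARTIC-INVERSION, HOME/INBOX.md l.12829).  Part XXVI of the lane `Census/QuarticInversion*`: theorems only, on top of parts I–XXV and the floors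
(`Census/QuarticInversionStabiliser.lean`; `|B|` odd ⇒ no element of order `4`, `Census/ClockTypesLaw.lean`), all BY NAME; no `decide`, no certificate, no named fact, no geometry, no `sorry`.  `Interfaces.lean`
(C1), every E term, B01, `Transposition/*`, `PortJoin/*` untouched.
HONEST FRAMING: `HC_CM` is NOT proved, here or anywhere in the tree; nothing here is a period, a count of record or a headline.

For a finite group `G` with a central involution `c` carrying a quartic inversion datum `D : Datum G c B ζ` over a finite abelian group `B` of
odd order `≥ 3` (`G = H₀ ⊔ y H₀ ⊔ t H₀ ⊔ t y H₀`, `H₀ = ℤ/2 × B`, `y` inverting `H₀` with `y² = (ζ, 0)`, `t` central over `H₀` with `t² = c`,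
`y t = c t y`; `ζ = 1`: `G ≅ Dic(ℤ/4 × B, c)`, `ζ = 0`: `G ≅ D(ℤ/4 × B)` with `c` the square of the element of order `4`), together with a
SLOT DATUM and a CROSS DATUM on `B` (`|P| + 1 = K`, `u₁ ≠ u₂ ∉ P`, `|Q| = K`, `w ∉ Q`, `s₀ ∈ P⁺`, `s + σ ∈ P⁺ ↔ s ∉ P⁺ ∨ s = s₀`,
`|B| = 2K + 1`; part XXVII provides them for `B = ℤ/(2K+1)`):
* §1 **EXISTENCE** (`exists_gfaces_generate`): a finite set `S'` of abstract rank-four faces with `|S'| ≤ β(G, c) = #Block c`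
  (`|S'| + 2 ≤ β` for `ζ = 0`) whose base changes, together with the pairs, span `hodgeSpan c` — transported from part XXIII.
* §2 **THE LAWS**: with the floors of `Census/QuarticInversionStabiliser.lean` (`φ₂ = β` for `ζ = 1` when `B` has no element of order `4` —
  automatic for `|B|` odd; `φ₂ = β − 2` for `ζ = 0`) the least number of abstract rank-four faces whose base changes, together with the pairs,
  span `hodgeSpan c` is EXACTLY `β` for `ζ = 1` (`isLeast_card_gfaces_generate_one`) and EXACTLY `β − 2` for `ζ = 0`
  (`isLeast_card_gfaces_generate_zero`).
Census dictionary: for a Galois CM field whose group carries such a datum (degree `8|B|`; e.g. `Dic₆ = Dic(ℤ/12)`-fields of degree `24` with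
`β = 172`, so EXACTLY `172` faces; `D₁₂`-fields with `c = r⁶`, `β = 204`, EXACTLY `202`) the Hodge ring of the whole slice is generated modulo
divisor classes by the Galois conjugates of exactly `β` resp. `β − 2` rank-four face classes, and no fewer Hodge generators exist modulo pairs.
`HC_CM` is NOT proved; nothing here is a period.  All [folklore].

## References
* [Pohlmann1968] H. Pohlmann, Algebraic cycles on abelian varieties of complex multiplication type, Ann. of Math. 88 (1968), Thm 1.
* [Milne1999] J. S. Milne, Lefschetz motives and the Tate conjecture, Compositio Math. 117 (1999), Prop. 2.1, p. 54.
-/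

namespace Summit.HodgeConjecture.CorCM.Census.QuarticInversion

open Finset
open Summit.HodgeConjecture.CorCM.Prior.AllgGroup.RfwfAllgGroup
open Summit.HodgeConjecture.CorCM.Census.BlockParity
open Summit.HodgeConjecture.CorCM.Census.Coinvariant
open Summit.HodgeConjecture.CorCM.Census.OddSliceFacesModel

noncomputable section

section General

variable {G : Type*} [Group G] [Fintype G] [DecidableEq G] {c : G}
variable {A : Type} [AddCommGroup A] [Fintype A] [DecidableEq A] {ζ : ZMod 2}
variable (D : Datum G c A ζ)

/-! ## §1 Existence -/

include D in
/-- **EXISTENCE: `μ(G, c) ≤ β(G, c)`** (every `ζ`; `|B|` odd `≥ 3` with a slot datum and a cross datum). [folklore] -/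
theorem exists_gfaces_generate (hc2 : c * c = 1) (hA : Odd (Fintype.card A)) (h3 : 3 ≤ Fintype.card A)
    (hSlot : ∃ (P : Finset A) (u₁ u₂ : A) (Q : Finset A) (w σ s₀ : A), u₁ ∉ P ∧ u₂ ∉ P ∧ u₁ ≠ u₂ ∧ P.card + 1 = Fintype.card A / 2 ∧
      s₀ ∈ insert u₁ (insert u₂ P) ∧ (∀ s, s + σ ∈ insert u₁ (insert u₂ P) ↔ (s ∉ insert u₁ (insert u₂ P) ∨ s = s₀)) ∧ w ∉ Q ∧
      Q.card = Fintype.card A / 2) :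
    ∃ S' : Finset (CMF G c →₀ ℤ), ↑S' ⊆ gfaceSet G c hc2 ∧ S'.card ≤ Fintype.card (BlockParity.Block c) ∧
      hodgeSpan c hc2 ≤ Submodule.span ℤ (pairSet c) ⊔ Submodule.span ℤ (translates c S') := by
  obtain ⟨P, u₁, u₂, Q, w, σ, s₀, h1, h2, h12, hP, hs₀, hX, hw, hQ⟩ := hSlot
  obtain ⟨S', hS', hcard, hgen⟩ := exists_gfaces_of_family D hc2 (F := family A ζ P u₁ u₂ Q w 0)
    (fun f hf => family_shape A ζ h12 hf) (hodge₄_le A ζ hA h3 h1 h2 h12 hP hs₀ hX hw hQ)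
  refine ⟨S', hS', ?_, hgen⟩
  have h := card_family_le A ζ (P := P) (u₁ := u₁) (u₂ := u₂) (Q := Q) (w := w) (u₀ := 0) hA (by omega)
  rw [card_block_eq D]
  omega

end General

/-! ## §2 The laws -/

section Zero

variable {G : Type*} [Group G] [Fintype G] [DecidableEq G] {c : G}
variable {A : Type} [AddCommGroup A] [Fintype A] [DecidableEq A]
variable (D : Datum G c A 0)

include D in
/-- **EXISTENCE for `ζ = 0`: `μ(G, c) ≤ β(G, c) − 2`.** [folklore] -/
theorem exists_gfaces_generate_zero (hc2 : c * c = 1) (hA : Odd (Fintype.card A)) (h3 : 3 ≤ Fintype.card A)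
    (hSlot : ∃ (P : Finset A) (u₁ u₂ : A) (Q : Finset A) (w σ s₀ : A), u₁ ∉ P ∧ u₂ ∉ P ∧ u₁ ≠ u₂ ∧ P.card + 1 = Fintype.card A / 2 ∧
      s₀ ∈ insert u₁ (insert u₂ P) ∧ (∀ s, s + σ ∈ insert u₁ (insert u₂ P) ↔ (s ∉ insert u₁ (insert u₂ P) ∨ s = s₀)) ∧ w ∉ Q ∧
      Q.card = Fintype.card A / 2) :
    ∃ S' : Finset (CMF G c →₀ ℤ), ↑S' ⊆ gfaceSet G c hc2 ∧ S'.card + 2 ≤ Fintype.card (BlockParity.Block c) ∧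
      hodgeSpan c hc2 ≤ Submodule.span ℤ (pairSet c) ⊔ Submodule.span ℤ (translates c S') := by
  obtain ⟨P, u₁, u₂, Q, w, σ, s₀, h1, h2, h12, hP, hs₀, hX, hw, hQ⟩ := hSlot
  obtain ⟨S', hS', hcard, hgen⟩ := exists_gfaces_of_family D hc2 (F := family A 0 P u₁ u₂ Q w 0)
    (fun f hf => family_shape A 0 h12 hf) (hodge₄_le A 0 hA h3 h1 h2 h12 hP hs₀ hX hw hQ)
  refine ⟨S', hS', ?_, hgen⟩
  have h := card_family_add_two_le A (P := P) (u₁ := u₁) (u₂ := u₂) (Q := Q) (w := w) (u₀ := 0) hA (by omega)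
  rw [card_block_eq D]
  omega

include D in
/-- **THE DIHEDRAL QUARTIC LAW: `μ(G, c) = β(G, c) − 2`** for `(G, c)` carrying a datum with `ζ = 0` (`G ≅ D(ℤ/4 × B)`, `c` the square of
the element of order `4`) over `B` of odd order `≥ 3` with a slot datum and a cross datum. [folklore] -/
theorem isLeast_card_gfaces_generate_zero (hc2 : c * c = 1) (hA : Odd (Fintype.card A)) (h3 : 3 ≤ Fintype.card A)
    (hSlot : ∃ (P : Finset A) (u₁ u₂ : A) (Q : Finset A) (w σ s₀ : A), u₁ ∉ P ∧ u₂ ∉ P ∧ u₁ ≠ u₂ ∧ P.card + 1 = Fintype.card A / 2 ∧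
      s₀ ∈ insert u₁ (insert u₂ P) ∧ (∀ s, s + σ ∈ insert u₁ (insert u₂ P) ↔ (s ∉ insert u₁ (insert u₂ P) ∨ s = s₀)) ∧ w ∉ Q ∧
      Q.card = Fintype.card A / 2) :
    IsLeast {m : ℕ | ∃ S : Finset (CMF G c →₀ ℤ), ↑S ⊆ gfaceSet G c hc2 ∧ S.card = m ∧
      hodgeSpan c hc2 ≤ Submodule.span ℤ (pairSet c) ⊔ Submodule.span ℤ (translates c S)} (Fintype.card (BlockParity.Block c) - 2) := by
  refine ⟨?_, le_of_mem_generating_of_zero D hc2⟩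
  obtain ⟨S, hS, hcard, hgen⟩ := exists_gfaces_generate_zero D hc2 hA h3 hSlot
  have hfloor := card_block_le_card_add_two_of_zero D hc2 S (fun _ hy => gfaceSet_subset_hodgeSpan c hc2 (hS hy))
    (fun _ hy => hgen (gfaceSet_subset_hodgeSpan c hc2 hy))
  exact ⟨S, hS, by omega, hgen⟩

end Zero

section One

variable {G : Type*} [Group G] [Fintype G] [DecidableEq G] {c : G}
variable {A : Type} [AddCommGroup A] [Fintype A] [DecidableEq A]
variable (D : Datum G c A 1)

include D in
/-- **THE DICYCLIC QUARTIC LAW: `μ(G, c) = β(G, c)`** for `(G, c)` carrying a datum with `ζ = 1` (`G ≅ Dic(ℤ/4 × B, c)`) over `B` of odd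
order `≥ 3` with a slot datum and a cross datum. [folklore] -/
theorem isLeast_card_gfaces_generate_one (hc2 : c * c = 1) (hA : Odd (Fintype.card A)) (h3 : 3 ≤ Fintype.card A)
    (hSlot : ∃ (P : Finset A) (u₁ u₂ : A) (Q : Finset A) (w σ s₀ : A), u₁ ∉ P ∧ u₂ ∉ P ∧ u₁ ≠ u₂ ∧ P.card + 1 = Fintype.card A / 2 ∧
      s₀ ∈ insert u₁ (insert u₂ P) ∧ (∀ s, s + σ ∈ insert u₁ (insert u₂ P) ↔ (s ∉ insert u₁ (insert u₂ P) ∨ s = s₀)) ∧ w ∉ Q ∧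
      Q.card = Fintype.card A / 2) :
    IsLeast {m : ℕ | ∃ S : Finset (CMF G c →₀ ℤ), ↑S ⊆ gfaceSet G c hc2 ∧ S.card = m ∧
      hodgeSpan c hc2 ≤ Submodule.span ℤ (pairSet c) ⊔ Submodule.span ℤ (translates c S)} (Fintype.card (BlockParity.Block c)) := by
  have hB : ∀ s : A, ¬ 4 ∣ addOrderOf s := ClockTypes.not_four_dvd_addOrderOf_of_odd hA
  refine ⟨?_, le_of_mem_generating_of_one D hB hc2⟩
  obtain ⟨S, hS, hcard, hgen⟩ := exists_gfaces_generate D hc2 hA h3 hSlot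
  have hfloor := card_block_le_card_of_one D hB hc2 S (fun _ hy => gfaceSet_subset_hodgeSpan c hc2 (hS hy))
    (fun _ hy => hgen (gfaceSet_subset_hodgeSpan c hc2 hy))
  exact ⟨S, hS, by omega, hgen⟩

end One

end

end Summit.HodgeConjecture.CorCM.Census.QuarticInversion
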